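import Literature.NumberTheory.Rogawski1990.ArchTestKcPackage                          -- ★ `archTestKc_dirac_package` (Dirac sequence in `ArchTestKc`, needs `hdef`), ★ `ArchTestKc.mulConv`, ★ `ArchTestKc.mulStar`
import Literature.NumberTheory.Automorphic.UnitaryGroupArchCharacterTraceClass          -- ★ A5 text `ArchIntegratedOperatorTraceClass` (Hilbert–Schmidt clause)
import Summits.HodgeConjecture.HodgeConjecture.Theorems.F0P3ArchTrOfAnyGlobalization    -- ★ `archIntegratedOperatorTraceClass_uTwoOne` (A5 hypothesis-free at `U(2,1)`)
import Summits.HodgeConjecture.HodgeConjecture.Theorems.K2E4ArchGlobalizationOfRecord   -- ★ `hasUnitaryGlobalization_of_isCohUnitaryClass`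
import Literature.NumberTheory.Automorphic.UnitaryGlobalizationIrreducibleProofs      -- ★ `isTopIrreducible_globOfRecord_of_admissible` (A7′ ★: the globalization of record is irreducible, hence non-zero)
import Summits.HodgeConjecture.HodgeConjecture.Theorems.R90S9SphericalClassTuple        -- ★ `InnerFormSec146.RepPrimeSph`, `tupleOf`, `tupleOf_fst` (brings ★ `F0P3UnitaryLocOfRecord`: `clInfChoiceU`, `isCohUnitaryClass_clInfChoiceU`)
import HarnessLib

/-!
# R90-TF · S9 «InnerForm-13.3.6 (c)» — THE ARCHIMEDEAN POSITIVE DETECTOR (payer-map row 24 ∕ B row 27) FROM THE ★ LABESSE–LANGLANDS TOOLKIT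

Cell `hodgecm-mathlib`, crux H413 (`stmt-HodgeConjecture-24833`, lane `--supports … --as helper`), route of record `HCCMUnconditional` (no route verbs; count-neutral).
Programme R90-TF (HUMAN RULING «R90-TF SLAB — MAX PUSH»; brief `director/R90-BRIEF.v2.md` 1f40d54518340a35), section S9 = InnerForm-13.3.6 (c) (base `R90-IF`); seat
R90-IF-p03 (g4); dealer R90-IF-plan (g3) RULING S9-R-α-2 (2026-09-05T04:01:33Z) «(R27-DET) census» → census `R90/R90-IF-p03/g4/CENSUS-R27-DET-archPosDetector.md`
(29d41f3f) → this payer.  THEOREMS ONLY: no `def`, no instance, no notation, no named fact, no `sorry`; imports ★ only; X-generic.  HONEST LABEL: HC_CM is proved only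
modulo the 7 printed citations (2 remaining named inputs: hLiu418 = stmt-HodgeConjecture-24832, h413 = stmt-HodgeConjecture-24833) — until rung 0 closes.  Pays no socket
by itself: FILE B's `sock_S9_archPosDetector_cm` (with the `hdef` guard, see the census §0.1) becomes `:= archPosDetector_of_toolkit` at the next edition.

## Statement and proof [Rogawski1990, §14.6 p. 242 l. 15–16, Thm. 14.6.4 p. 244; §14.2 p. 233] [LabesseLanglands1979, Lemma 6.1 p. 768]
For a CM frame `(L, ι, H, T)` with `H` DEFINITE away from `ι` (`hdef` — the factor `K_c` is then compact), an automorphic measure `μ` and a Haar measure `νinf` on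
`G′_∞ = U(H)(L⁺ ⊗ ℝ)`: for every `K_c`-spherical discrete class `π′` there is an archimedean test function `φ ∈ ArchTestKc` with `Θ_{π_∞}(φ) ≥ 0` for EVERY
`K_c`-spherical `π` and `Θ_{π′_∞}(φ) ≠ 0` (`Θ` = ★ `archTr₀` at the archimedean coordinate ★ `(tupleOf π).1`).  NOT via Plancherel ∕ Paley–Wiener: take `φ := f^* ⋆ f`
(★ `ArchTestKc.mulStar`, ★ `ArchTestKc.mulConv`); then for any unitary globalization `ϖ`, `ϖ(φ) = ϖ(f)† ϖ(f)` (★ `adjoint_integratedOperator`, ★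
`integratedOperator_comp_integratedOperator`; `νinf` is inversion invariant since `G′_∞` is unimodular, ★ `modularCharacterFun_arch_eq_one`), so
`Θ_x(φ) = Σ_k ‖ϖ_x(f) e_k‖² ≥ 0` (§1–§2); the archimedean coordinate of EVERY spherical class has a unitary globalization (it is a coh-unitary class — genuine or
default branch of ★ `clInfChoiceU` — ★ `isCohUnitaryClass_clInfChoiceU` + ★ `hasUnitaryGlobalization_of_isCohUnitaryClass`), and for `f := φ_n` in the ★ Dirac sequence
of `ArchTestKc` (★ `archTestKc_dirac_package`, where `hdef` enters) `ϖ′(φ_n) v → v`, so some `ϖ′(φ_n) ≠ 0`, whence `Σ_k ‖ϖ′(φ_n) e_k‖² > 0` (summable: ★ A5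
`archIntegratedOperatorTraceClass_uTwoOne`) (§3–§4).

## References
* [Rogawski1990] J. D. Rogawski, *Automorphic Representations of Unitary Groups in Three Variables*, Ann. of Math. Stud. 123 (1990): §14.6 p. 242, Thm. 14.6.4
  p. 244; §14.2 p. 233; §13.8 Prop. 13.8.1 p. 212.
* [LabesseLanglands1979] J.-P. Labesse, R. P. Langlands, *L-indistinguishability for SL(2)*, Canad. J. Math. 31 (1979): Lemma 6.1 p. 768.
* [DeitmarEchterhoff2014] A. Deitmar, S. Echterhoff, *Principles of Harmonic Analysis*, 2nd ed. (2014): Prop. 6.2.1, Lemma 6.2.2.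
* [Knapp1986] A. Knapp, *Representation Theory of Semisimple Groups* (1986): Thm. 10.2.
-/

set_option autoImplicit false
-- the mandated namespace repeats `HodgeConjecture.HodgeConjecture`, as in every `Theorems/*.lean` of this sub-problem
set_option linter.dupNamespace false

noncomputable section

open NumberField MeasureTheory CompactlySupported Filter Topology
open scoped Matrix ComplexConjugate InnerProductSpace ENNReal NNReal ComplexOrder
open Literature.NumberTheory Literature.NumberTheory.Automorphic Literature.NumberTheory.Automorphic.UnitaryGroup
open Literature.NumberTheory.Rogawski1990
open Literature.RepresentationTheory Literature.RepresentationTheory.KonnoKonno2007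
open Summit.HodgeConjecture.HodgeConjecture.Cruxes.H413

namespace Summit.HodgeConjecture.HodgeConjecture.R90.S9

section Detector

variable (L : Type) [Field L] [NumberField L] [IsCMField L] (ι : L →+* ℂ) (H : Matrix (Fin 3) (Fin 3) L) (T : GL (Fin 3) ℂ)
  (hT : (T : Matrix (Fin 3) (Fin 3) ℂ)ᴴ * H.map ι * (T : Matrix (Fin 3) (Fin 3) ℂ) = Literature.Geometry.ComplexHyperbolic.BallModel.J)

/-! ## §1 `Θ_x(f^* ⋆ f) = Σ_k ‖ϖ_x(f) e_k‖²` along the globalization and basis of record -/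

set_option synthInstance.maxHeartbeats 400000 in
set_option maxHeartbeats 4000000 in
/-- **`Θ_x(f^* ⋆ f) = Σ_k ‖(ϖ_x ∘ proj)(f) e_k‖²`** (as a real series cast to `ℂ`) for a class `x` with a unitary globalization, a Haar measure `νinf` on `G′_∞` and
`f ∈ ArchTestKc`: `ϖ(f^* ⋆ f) = ϖ(f^*) ϖ(f) = ϖ(f)† ϖ(f)` (★ `integratedOperator_comp_integratedOperator`, ★ `adjoint_integratedOperator`; inversion invariance of `νinf`
from unimodularity of `U(H)(L⁺ ⊗ ℝ)`, ★ `modularCharacterFun_arch_eq_one`) and `⟪e, A†A e⟫ = ‖A e‖²`.  The computation of ★ `archRealCase_of_package` for one class.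
[cite: LabesseLanglands1979, Lemma 6.1 p. 768] [cite: DeitmarEchterhoff2014, Prop. 6.2.1] [cite: Rogawski1990, §13.8 Prop. 13.8.1 p. 212] -/
theorem archTr₀_mulConv_mulStar_eq_tsum_norm_sq
    (νinf : @Measure (UnitaryGroup.arch (↥(maximalRealSubfield L)) L (IsCMField.complexConj L) 3 H) (borel _))
    (hν : @Measure.IsHaarMeasure _ _ _ (borel _) νinf) {x : GKIrrClass (uFormGroup (Fin 2) (Fin 1))}
    (hx : HasUnitaryGlobalization (uFormGroup (Fin 2) (Fin 1)) x)
    {f : UnitaryGroup.arch (↥(maximalRealSubfield L)) L (IsCMField.complexConj L) 3 H → ℂ} (hf : ArchTestKc L ι H T hT f) :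
    archTr₀ L ι H T hT νinf x (letI : MeasurableSpace (UnitaryGroup.arch (↥(maximalRealSubfield L)) L (IsCMField.complexConj L) 3 H) := borel _;
        mulConv νinf (mulStar f) f) =
      ((letI : MeasurableSpace (UnitaryGroup.arch (↥(maximalRealSubfield L)) L (IsCMField.complexConj L) 3 H) := borel _
        haveI : BorelSpace (UnitaryGroup.arch (↥(maximalRealSubfield L)) L (IsCMField.complexConj L) 3 H) := ⟨rfl⟩
        haveI : IsFiniteMeasureOnCompacts νinf := by haveI := hν; infer_instance
        ∑' k, ‖((globOfRecord x hx).ϖ.restrict (archProjUForm L ι H T hT)).integratedOperator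
            ((globOfRecord x hx).isUnitaryGlobalization.isUnitary.restrict _)
            ((globOfRecord x hx).isUnitaryGlobalization.isStronglyContinuous.restrict _ (continuous_archProjUForm L ι H T hT))
            νinf ⟨⟨f, hf.continuous⟩, hf.hasCompactSupport⟩ (globBasis x hx k)‖ ^ 2 : ℝ) : ℂ) := by
  letI mS : MeasurableSpace (UnitaryGroup.arch (↥(maximalRealSubfield L)) L (IsCMField.complexConj L) 3 H) := borel _
  haveI : BorelSpace (UnitaryGroup.arch (↥(maximalRealSubfield L)) L (IsCMField.complexConj L) 3 H) := ⟨rfl⟩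
  haveI : νinf.IsHaarMeasure := hν
  haveI : νinf.IsMulRightInvariant :=
    isMulRightInvariant_of_modularCharacterFun_eq_one
      (fun g => modularCharacterFun_arch_eq_one L H (transpose_map_cmConjRingHom_eq_of_frame L ι H T hT)
        (isUnit_det_of_frame L ι H T hT).ne_zero g) νinf
  haveI : νinf.IsInvInvariant := isInvInvariant_of_isMulRightInvariant νinf
  have hfs : ArchTestKc L ι H T hT (mulStar f) := hf.mulStar
  have hψ : ArchTestKc L ι H T hT (mulConv νinf (mulStar f) f) := hfs.mulConv L ι H T hT νinf hν hf
  -- names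
  set W := globOfRecord x hx with hW
  set π : ContRepresentation ℂ (UnitaryGroup.arch (↥(maximalRealSubfield L)) L (IsCMField.complexConj L) 3 H) W.E :=
    W.ϖ.restrict (archProjUForm L ι H T hT) with hπ
  have hu : π.IsUnitary := W.isUnitaryGlobalization.isUnitary.restrict _
  have hc : π.IsStronglyContinuous := W.isUnitaryGlobalization.isStronglyContinuous.restrict _ (continuous_archProjUForm L ι H T hT)
  let fc : C_c(UnitaryGroup.arch (↥(maximalRealSubfield L)) L (IsCMField.complexConj L) 3 H, ℂ) := ⟨⟨f, hf.continuous⟩, hf.hasCompactSupport⟩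
  let fs : C_c(UnitaryGroup.arch (↥(maximalRealSubfield L)) L (IsCMField.complexConj L) 3 H, ℂ) := ⟨⟨mulStar f, hfs.continuous⟩, hfs.hasCompactSupport⟩
  let ψ : C_c(UnitaryGroup.arch (↥(maximalRealSubfield L)) L (IsCMField.complexConj L) 3 H, ℂ) :=
    ⟨⟨mulConv νinf (mulStar f) f, hψ.continuous⟩, hψ.hasCompactSupport⟩
  have hcomp : π.integratedOperator hu hc νinf ψ = π.integratedOperator hu hc νinf fs ∘L π.integratedOperator hu hc νinf fc :=
    (ContRepresentation.integratedOperator_comp_integratedOperator hu hc νinf fs fc ψ fun _ => rfl).symm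
  have hadj : π.integratedOperator hu hc νinf fs = ContinuousLinearMap.adjoint (π.integratedOperator hu hc νinf fc) :=
    (ContRepresentation.adjoint_integratedOperator hu hc νinf fc fs fun _ => rfl).symm
  rw [archTr₀_eq_tsum L ι H T hT νinf x _ hx hψ.continuous hψ.hasCompactSupport inferInstance, Complex.ofReal_tsum]
  refine tsum_congr fun k => ?_
  change ⟪(globBasis x hx k : W.E), π.integratedOperator hu hc νinf ψ (globBasis x hx k)⟫_ℂ = _
  rw [hcomp, ContinuousLinearMap.comp_apply, hadj, ContinuousLinearMap.adjoint_inner_right, inner_self_eq_norm_sq_to_K]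
  norm_cast

/-! ## §2 Positivity: `Θ_x(f^* ⋆ f) ≥ 0` for EVERY class `x` (junk branches included) -/

set_option synthInstance.maxHeartbeats 400000 in
set_option maxHeartbeats 4000000 in
/-- **`0 ≤ Θ_x(f^* ⋆ f)`** for every class `x`: on the good branch §1 (a series of squares of norms, `≥ 0` whether summable or not), off it ★ `archTr₀ = 0`.
[cite: LabesseLanglands1979, Lemma 6.1 p. 768] [cite: Rogawski1990, §14.6 p. 242] -/
theorem archTr₀_mulConv_mulStar_nonneg
    (νinf : @Measure (UnitaryGroup.arch (↥(maximalRealSubfield L)) L (IsCMField.complexConj L) 3 H) (borel _))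
    (hν : @Measure.IsHaarMeasure _ _ _ (borel _) νinf) (x : GKIrrClass (uFormGroup (Fin 2) (Fin 1)))
    {f : UnitaryGroup.arch (↥(maximalRealSubfield L)) L (IsCMField.complexConj L) 3 H → ℂ} (hf : ArchTestKc L ι H T hT f) :
    0 ≤ archTr₀ L ι H T hT νinf x (letI : MeasurableSpace (UnitaryGroup.arch (↥(maximalRealSubfield L)) L (IsCMField.complexConj L) 3 H) := borel _;
        mulConv νinf (mulStar f) f) := by
  by_cases hx : HasUnitaryGlobalization (uFormGroup (Fin 2) (Fin 1)) x
  · rw [archTr₀_mulConv_mulStar_eq_tsum_norm_sq L ι H T hT νinf hν hx hf]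
    exact Complex.zero_le_real.2 (tsum_nonneg fun _ => by positivity)
  · rw [archTr₀_of_not_hasUnitaryGlobalization L ι H T hT νinf x hx]

/-! ## §3 Non-vanishing: `Θ_x(f^* ⋆ f) ≠ 0` as soon as `(ϖ_x ∘ proj)(f) ≠ 0` -/

set_option synthInstance.maxHeartbeats 400000 in
set_option maxHeartbeats 4000000 in
/-- **`Θ_x(f^* ⋆ f) ≠ 0` if `(ϖ_x ∘ proj)(f) ≠ 0`** on the globalization of record: the series `Σ_k ‖ϖ(f) e_k‖²` is summable (Hilbert–Schmidt: ★ A5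
`archIntegratedOperatorTraceClass_uTwoOne`) with a positive term (a bounded operator killing a Hilbert basis is `0`).
[cite: Knapp1986, Thm. 10.2] [cite: LabesseLanglands1979, Lemma 6.1 p. 768] -/
theorem archTr₀_mulConv_mulStar_ne_zero
    (νinf : @Measure (UnitaryGroup.arch (↥(maximalRealSubfield L)) L (IsCMField.complexConj L) 3 H) (borel _))
    (hν : @Measure.IsHaarMeasure _ _ _ (borel _) νinf) {x : GKIrrClass (uFormGroup (Fin 2) (Fin 1))}
    (hx : HasUnitaryGlobalization (uFormGroup (Fin 2) (Fin 1)) x)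
    {f : UnitaryGroup.arch (↥(maximalRealSubfield L)) L (IsCMField.complexConj L) 3 H → ℂ} (hf : ArchTestKc L ι H T hT f)
    (hne : (letI : MeasurableSpace (UnitaryGroup.arch (↥(maximalRealSubfield L)) L (IsCMField.complexConj L) 3 H) := borel _
      haveI : BorelSpace (UnitaryGroup.arch (↥(maximalRealSubfield L)) L (IsCMField.complexConj L) 3 H) := ⟨rfl⟩
      haveI : IsFiniteMeasureOnCompacts νinf := by haveI := hν; infer_instance
      ((globOfRecord x hx).ϖ.restrict (archProjUForm L ι H T hT)).integratedOperator
          ((globOfRecord x hx).isUnitaryGlobalization.isUnitary.restrict _)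
          ((globOfRecord x hx).isUnitaryGlobalization.isStronglyContinuous.restrict _ (continuous_archProjUForm L ι H T hT))
          νinf ⟨⟨f, hf.continuous⟩, hf.hasCompactSupport⟩) ≠ 0) :
    archTr₀ L ι H T hT νinf x (letI : MeasurableSpace (UnitaryGroup.arch (↥(maximalRealSubfield L)) L (IsCMField.complexConj L) 3 H) := borel _;
        mulConv νinf (mulStar f) f) ≠ 0 := by
  letI mS : MeasurableSpace (UnitaryGroup.arch (↥(maximalRealSubfield L)) L (IsCMField.complexConj L) 3 H) := borel _
  haveI : BorelSpace (UnitaryGroup.arch (↥(maximalRealSubfield L)) L (IsCMField.complexConj L) 3 H) := ⟨rfl⟩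
  haveI : νinf.IsHaarMeasure := hν
  rw [archTr₀_mulConv_mulStar_eq_tsum_norm_sq L ι H T hT νinf hν hx hf, Complex.ofReal_ne_zero]
  set W := globOfRecord x hx with hW
  set A := (W.ϖ.restrict (archProjUForm L ι H T hT)).integratedOperator (W.isUnitaryGlobalization.isUnitary.restrict _)
      (W.isUnitaryGlobalization.isStronglyContinuous.restrict _ (continuous_archProjUForm L ι H T hT)) νinf ⟨⟨f, hf.continuous⟩, hf.hasCompactSupport⟩ with hA
  -- Hilbert–Schmidt summability from A5 (★, hypothesis-free at `U(2,1)`)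
  have hHS : Summable fun k => ‖A (globBasis x hx k)‖ ^ 2 := by
    have h1 := (F0P3ArchTrOfAnyGlobalization.archIntegratedOperatorTraceClass_uTwoOne L ι H T hT νinf hν x W.E W.ϖ W.isUnitaryGlobalization f
      hf.continuous hf.hasCompactSupport hf.1 _ (globBasis x hx)).1
    have hs : Summable fun k => ‖A (globBasis x hx k)‖₊ ^ 2 := by
      rw [← ENNReal.tsum_coe_ne_top_iff_summable]
      simpa only [ENNReal.coe_pow] using h1.ne
    simpa only [NNReal.coe_pow, coe_nnnorm] using NNReal.summable_coe.2 hs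
  -- some basis vector is not killed by `A`
  have hk : ∃ k, A (globBasis x hx k) ≠ 0 := by
    by_contra hall
    push Not at hall
    apply hne
    refine ContinuousLinearMap.ext fun v => ?_
    have hsum := ((globBasis x hx).hasSum_repr v).mapL A
    simp only [map_smul, hall, smul_zero] at hsum
    simpa using hsum.tsum_eq.symm.trans tsum_zero
  obtain ⟨k, hk⟩ := hk
  exact ne_of_gt (lt_of_lt_of_le (by positivity : (0 : ℝ) < ‖A (globBasis x hx k)‖ ^ 2)
    (hHS.le_tsum k fun _ _ => by positivity))

/-! ## §4 The detector -/

set_option synthInstance.maxHeartbeats 400000 in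
set_option maxHeartbeats 8000000 in
/-- **THE ARCHIMEDEAN POSITIVE DETECTOR** (FILE B's `SocketArchPosDetectorCm` WITH the `hdef` guard): for a CM frame `(L, ι, H, T)` with `H` definite away from `ι`,
an automorphic measure `μ` and a Haar measure `νinf` on `G′_∞`, every `K_c`-spherical discrete class `π′` admits `φ ∈ ArchTestKc` with `0 ≤ Θ_{(tupleOf π).1}(φ)` for all
`K_c`-spherical `π` and `Θ_{(tupleOf π′).1}(φ) ≠ 0` — `φ := φ_n^* ⋆ φ_n` for a member `φ_n` of the ★ Dirac sequence of `ArchTestKc` not killed by the globalization of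
record of `(tupleOf π′).1` (§1–§3; the archimedean coordinate of every spherical class is coh-unitary, hence has a unitary globalization).
[cite: Rogawski1990, §14.6 p. 242 l. 15–16, Thm. 14.6.4 p. 244; §14.2 p. 233] [cite: LabesseLanglands1979, Lemma 6.1 p. 768] [cite: DeitmarEchterhoff2014, Lemma 6.2.2] -/
theorem archPosDetector_of_toolkit (hdef : ∀ τ' : L →+* ℂ, InfinitePlace.mk τ' ≠ InfinitePlace.mk ι → (H.map τ').PosDef)
    (μ : Measure (adelicGroupData (↥(maximalRealSubfield L)) L (IsCMField.complexConj L) 3 H).automorphicQuotient)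
    [(adelicGroupData (↥(maximalRealSubfield L)) L (IsCMField.complexConj L) 3 H).IsAutomorphicMeasure μ]
    (νinf : @Measure (UnitaryGroup.arch (↥(maximalRealSubfield L)) L (IsCMField.complexConj L) 3 H) (borel _))
    (hνinf : letI : MeasurableSpace (UnitaryGroup.arch (↥(maximalRealSubfield L)) L (IsCMField.complexConj L) 3 H) := borel _; νinf.IsHaarMeasure)
    (π' : InnerFormSec146.RepPrimeSph L ι H T hT μ) :
    ∃ φ : UnitaryGroup.arch (↥(maximalRealSubfield L)) L (IsCMField.complexConj L) 3 H → ℂ, ArchTestKc L ι H T hT φ ∧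
      (∀ π : InnerFormSec146.RepPrimeSph L ι H T hT μ, 0 ≤ archTr₀ L ι H T hT νinf (InnerFormSec146.tupleOf L ι H T hT μ π).1 φ) ∧
      archTr₀ L ι H T hT νinf (InnerFormSec146.tupleOf L ι H T hT μ π').1 φ ≠ 0 := by
  letI mS : MeasurableSpace (UnitaryGroup.arch (↥(maximalRealSubfield L)) L (IsCMField.complexConj L) 3 H) := borel _
  haveI : BorelSpace (UnitaryGroup.arch (↥(maximalRealSubfield L)) L (IsCMField.complexConj L) 3 H) := ⟨rfl⟩
  haveI : νinf.IsHaarMeasure := hνinf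
  -- the archimedean coordinate of a spherical class is a coh-unitary class (genuine or default branch), hence has a unitary globalization
  have hcoh : ∀ π : InnerFormSec146.RepPrimeSph L ι H T hT μ,
      F0P3UnitaryLocOfRecord.IsCohUnitaryClass (InnerFormSec146.tupleOf L ι H T hT μ π).1 := fun π => by
    rw [InnerFormSec146.tupleOf_fst]
    exact F0P3UnitaryLocOfRecord.isCohUnitaryClass_clInfChoiceU L H ι T hT μ
      (F0P3UnitaryLocOfRecord.isCohUnitaryClass_archDegOneClass 1 (Or.inl rfl)) _
  have hglob : ∀ π : InnerFormSec146.RepPrimeSph L ι H T hT μ,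
      HasUnitaryGlobalization (uFormGroup (Fin 2) (Fin 1)) (InnerFormSec146.tupleOf L ι H T hT μ π).1 := fun π =>
    K2E4ArchGlobalizationOfRecord.hasUnitaryGlobalization_of_isCohUnitaryClass _ (hcoh π)
  set x' := (InnerFormSec146.tupleOf L ι H T hT μ π').1 with hx'
  set W := globOfRecord x' (hglob π') with hW
  -- the Dirac sequence of `ArchTestKc` (this is where `hdef` is used) does not annihilate `W` (irreducible, hence non-zero: ★ A7′)
  obtain ⟨φn, hφn, hDirac⟩ := archTestKc_dirac_package L ι H T hT νinf hdef hνinf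
  have hadm : ∃ r : GKIrrep (uFormGroup (Fin 2) (Fin 1)), GKIrrClass.mk r = x' ∧ IsAdmissibleGK r.ρK := by
    obtain ⟨r, hr, hcu⟩ := hcoh π'
    exact ⟨r, hr, hcu.adm⟩
  haveI : Nontrivial W.E :=
    ((ContRepresentation.isTopIrreducible_iff _).1 (isTopIrreducible_globOfRecord_of_admissible x' hadm (hglob π'))).1
  obtain ⟨v, hv⟩ := exists_ne (0 : W.E)
  have hTend := hDirac x' W.E W.ϖ W.isUnitaryGlobalization v
  have hn : ∃ n, (W.ϖ.restrict (archProjUForm L ι H T hT)).integratedOperator (W.isUnitaryGlobalization.isUnitary.restrict _)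
      (W.isUnitaryGlobalization.isStronglyContinuous.restrict _ (continuous_archProjUForm L ι H T hT)) νinf
      ⟨⟨φn n, (hφn n).continuous⟩, (hφn n).hasCompactSupport⟩ ≠ 0 := by
    by_contra hall
    push Not at hall
    have h0 : Tendsto (fun _ : ℕ => (0 : W.E)) atTop (𝓝 v) := hTend.congr fun n => by rw [hall n, zero_apply]
    exact hv (tendsto_nhds_unique h0 tendsto_const_nhds)
  obtain ⟨n, hn⟩ := hn
  refine ⟨mulConv νinf (mulStar (φn n)) (φn n), (hφn n).mulStar.mulConv L ι H T hT νinf hνinf (hφn n),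
    fun π => archTr₀_mulConv_mulStar_nonneg L ι H T hT νinf hνinf _ (hφn n), ?_⟩
  exact archTr₀_mulConv_mulStar_ne_zero L ι H T hT νinf hνinf (hglob π') (hφn n) hn

end Detector

end Summit.HodgeConjecture.HodgeConjecture.R90.S9

end
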